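import Mathlib
import Literature.NumberTheory.Transcendental.KZCalculusProofs
import Literature.NumberTheory.Transcendental.KZLogCalculusProofs
import Literature.NumberTheory.Transcendental.KZDominatedFamilyRelations
import Literature.NumberTheory.Transcendental.KZSemialgebraicComplex
import Literature.NumberTheory.Transcendental.KZIdealTetrahedron
import Summits.KontsevichZagierPeriods.KontsevichZagierPeriods.Theorems.HyperbolicBlochOffTetraSectorKernelStubEulerReflection
import Summits.KontsevichZagierPeriods.KontsevichZagierPeriods.Theorems.HyperbolicBlochOffTetraSectorKernelStubDilogDuplication
import Summits.KontsevichZagierPeriods.KontsevichZagierPeriods.Theorems.HyperbolicBlochOffTetraSectorKernelStubDilogLanden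

/-!
# `OffTetraSectorKernel`, line `odd-hyperbolic-ladder`: Landen's golden evaluation inside the
calculus (stub `stub_goldenDilog`)

Stub `stub_goldenDilog` of the crux `OffTetraSectorKernel` (stmt-KontsevichZagierPeriods-10557,
route HyperbolicBloch). Write `Li₂(a) = ∬_{0<v<u<a} du dv/(u(1−v))` and let
`x₀ = (√5 − 1)/2 = φ⁻¹`, the positive root of `t² + t − 1`, so that `x₀² = 1 − x₀ = φ⁻²` and
`x₀²/(1 − x₀²) = x₀`. LANDEN'S GOLDEN EVALUATION `Li₂(φ⁻²) = π²/15 − log²φ` holds INSIDE the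
Kontsevich–Zagier calculus as the integer identity

  `2·[Li₂(1)] ≡ 5·[G] + [S] + 2·[P]   (mod relations)`,

`G = [{0<v<u<x₀²}, 1/(u(1−v))]` (`Li₂(φ⁻²)`), `S = [(0,x₀²)², 1/((1−u)(1−v))]` (`log²φ`),
`P = [{x₀<u<1, 0<v<x₀}, 1/(u(1−v))]` (`log x₀ · log(1 − x₀) = 2 log²φ`). It is obtained from the
three functional equations already landed on this line, evaluated at the golden section:

* Euler's reflection at `x₀` (`stub_eulerReflection`): `[L₁] − [A] − [P] − [G] ∈ relations`,
  where `A = [{0<v<u<x₀}, 1/(u(1−v))]` (`Li₂(x₀)`) is the restriction of `L₁` and the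
  `Li₂(1 − x₀)`-triangle IS `G` (`1 − x₀ = x₀²`);
* duplication at `x₀` (`stub_dilogDuplication`): `[G] − 2[A] + 2[C] ∈ relations`,
  `C = [{0<v<u<x₀}, 1/(u(1+v))]` (`−Li₂(−x₀)`; integrable by domination `1/(u(1+v)) ≤ 1/(u(1−v))`);
* Landen at `x₀²` (`stub_dilogLanden`, `y = x₀²/(1 − x₀²) = x₀`): `[C] − [G] − [Q] ∈ relations`
  and `2[Q] − [S] ∈ relations`, `Q = [{0<v<u<x₀²}, 1/((1−u)(1−v))]` the restriction of `S`;

and the bookkeeping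
`5[G] + [S] + 2[P] − 2[L₁] = ([G] − 2[A] + 2[C]) − 2([L₁] − [A] − [P] − [G]) − 2([C] − [G] − [Q]) − (2[Q] − [S])`.

References: M. Kontsevich, D. Zagier, *Periods* (2001), §1.2; J. Landen, *Mathematical memoirs*
(1780) (the values `Li₂(φ⁻²)`, `Li₂(φ⁻¹)`); L. Lewin, *Polylogarithms and associated functions*
(1981), §1.6.
-/

noncomputable section

open Set MeasureTheory MvPolynomial
open Literature.NumberTheory.Transcendental Literature.ModelTheory.ExponentialFields

namespace Summit.KontsevichZagierPeriods.HyperbolicBloch.OffTetraSectorKernel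

/-! ### The golden section `x₀ = (√5 − 1)/2` -/

/-- `x₀ = (√5 − 1)/2` is a root of `t² + t − 1`: `x₀² = 1 − x₀`. [folklore] -/
theorem goldenDilog_sq : ((Real.sqrt 5 - 1) / 2) ^ 2 = 1 - (Real.sqrt 5 - 1) / 2 := by
  have h5 : Real.sqrt 5 ^ 2 = 5 := Real.sq_sqrt (by norm_num)
  linear_combination (1 / 4 : ℝ) * h5

/-- `0 < (√5 − 1)/2` (`1 < √5`). [folklore] -/
theorem goldenDilog_pos : 0 < (Real.sqrt 5 - 1) / 2 := by
  have h5 : Real.sqrt 5 ^ 2 = 5 := Real.sq_sqrt (by norm_num)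
  nlinarith [h5, Real.sqrt_nonneg 5]

/-- `(√5 − 1)/2 < 1` (`√5 < 3`). [folklore] -/
theorem goldenDilog_lt_one : (Real.sqrt 5 - 1) / 2 < 1 := by
  have h5 : Real.sqrt 5 ^ 2 = 5 := Real.sq_sqrt (by norm_num)
  nlinarith [h5, Real.sqrt_nonneg 5]

/-- `(√5 − 1)/2` is a real algebraic number (`√5` is a square root of the rational `5`).
[folklore] -/
theorem goldenDilog_isAlgebraic : IsAlgebraic ℚ ((Real.sqrt 5 - 1) / 2) := by
  have h5 : IsAlgebraic ℚ (Real.sqrt 5) := by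
    refine IsAlgebraic.of_pow two_pos ?_
    rw [Real.sq_sqrt (by norm_num : (0 : ℝ) ≤ 5)]
    exact isAlgebraic_nat 5
  rw [div_eq_mul_inv]
  exact (h5.sub isAlgebraic_one).mul (isAlgebraic_nat 2).inv

/-! ### The `Li₂(a)`-triangle is `ℚ`-semialgebraic for real-algebraic `a` -/

/-- The triangle `{0 < v < u < a}` is `ℚ`-semialgebraic for real-algebraic `a` (real algebraic
constants are `ℚ`-definable). [cite: KontsevichZagier2001, §1.1] -/
theorem goldenDilog_isSemialgebraic_triangle {a : ℝ} (ha : IsAlgebraic ℚ a) :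
    IsSemialgebraic ℚ {w : Fin 2 → ℝ | 0 < w 1 ∧ w 1 < w 0 ∧ w 0 < a} := by
  have hU : IsSemialgebraic ℚ (univ : Set (Fin 2 → ℝ)) := isSemialgebraic_univ
  have hco : ∀ i : Fin 2, IsSemialgebraicFunOn ℚ (univ : Set (Fin 2 → ℝ)) (fun p => p i) :=
    fun i => isSemialgebraicFunOn_apply hU i
  have S1 : IsSemialgebraic ℚ {p : Fin 2 → ℝ | 0 < p 1} :=
    isSemialgebraic_setOf_lt_of_isSemialgebraicFunOn
      (isSemialgebraicFunOn_const_of_isAlgebraic hU isAlgebraic_zero) (hco 1)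
  have S2 : IsSemialgebraic ℚ {p : Fin 2 → ℝ | p 1 < p 0} :=
    isSemialgebraic_setOf_lt_of_isSemialgebraicFunOn (hco 1) (hco 0)
  have S3 : IsSemialgebraic ℚ {p : Fin 2 → ℝ | p 0 < a} :=
    isSemialgebraic_setOf_lt_of_isSemialgebraicFunOn (hco 0)
      (isSemialgebraicFunOn_const_of_isAlgebraic hU ha)
  convert S1.inter (S2.inter S3) using 1
  ext w
  simp only [mem_inter_iff, mem_setOf_eq]

/-! ### The stub -/

/-- STUB `stub_goldenDilog`: LANDEN'S GOLDEN EVALUATION INSIDE THE CALCULUS. With `x₀ = (√5 − 1)/2 = φ⁻¹`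
(so `x₀² = 1 − x₀ = φ⁻²` and `x₀²/(1 − x₀²) = x₀`): `2·[Li₂(1)] ≡ 5·[Li₂(φ⁻²)] + [S] + 2·[P]`, where
`S = [(0,φ⁻²)², 1/((1−u)(1−v))]` (value `log²φ`) and `P = [{φ⁻¹<u<1, 0<v<φ⁻¹}, 1/(u(1−v))]` (value
`2 log²φ`) — i.e. `Li₂(φ⁻²) = π²/15 − log²φ` (Landen 1780) as a chain of moves: Euler reflection at `x₀`
(`stub_eulerReflection`; `Li₂(1−x₀) = Li₂(x₀²)` is the SAME representation), duplication at `x₀`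
(`stub_dilogDuplication`) and Landen at `x₀²` (`stub_dilogLanden`, `y = x₀`), then elimination of
`[Li₂(x₀)]` and `[−Li₂(−x₀)]` by integer bookkeeping. [cite: KontsevichZagier2001, §1.2] -/
theorem stub_goldenDilog :
    ∀ (L₁ G P S : KZ.IntegralRep 2),
      L₁.domain = {w | 0 < w 1 ∧ w 1 < w 0 ∧ w 0 < 1} →
      Set.EqOn L₁.integrand (fun w => 1 / (w 0 * (1 - w 1))) L₁.domain →
      G.domain = {w | 0 < w 1 ∧ w 1 < w 0 ∧ w 0 < ((Real.sqrt 5 - 1) / 2) ^ 2} →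
      Set.EqOn G.integrand (fun w => 1 / (w 0 * (1 - w 1))) G.domain →
      P.domain = {w | (Real.sqrt 5 - 1) / 2 < w 0 ∧ w 0 < 1 ∧ 0 < w 1 ∧ w 1 < (Real.sqrt 5 - 1) / 2} →
      Set.EqOn P.integrand (fun w => 1 / (w 0 * (1 - w 1))) P.domain →
      S.domain = {w | 0 < w 0 ∧ w 0 < ((Real.sqrt 5 - 1) / 2) ^ 2 ∧ 0 < w 1 ∧ w 1 < ((Real.sqrt 5 - 1) / 2) ^ 2} →
      Set.EqOn S.integrand (fun w => 1 / ((1 - w 0) * (1 - w 1))) S.domain →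
      5 • KZ.of G + KZ.of S + 2 • KZ.of P - 2 • KZ.of L₁ ∈ KZ.relations := by
  intro L₁ G P S hL₁ hL₁i hG hGi hP hPi hS hSi
  -- the golden section `x₀`
  have hsq := goldenDilog_sq
  have hx0 := goldenDilog_pos
  have hx1 := goldenDilog_lt_one
  have halg := goldenDilog_isAlgebraic
  set x₀ : ℝ := (Real.sqrt 5 - 1) / 2 with hx₀
  have hne : x₀ ≠ 0 := hx0.ne'
  have hsq' : 1 - x₀ ^ 2 = x₀ := by
    rw [hsq]
    ring
  have hy : x₀ ^ 2 / (1 - x₀ ^ 2) = x₀ := by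
    rw [hsq', sq, mul_div_cancel_right₀ _ hne]
  have hx20 : 0 < x₀ ^ 2 := pow_pos hx0 2
  have hx21 : x₀ ^ 2 < 1 := by
    rw [hsq]
    linarith
  have halg2 : IsAlgebraic ℚ (x₀ ^ 2) := halg.pow 2
  -- `A = [{0<v<u<x₀}, 1/(u(1−v))]` (`Li₂(x₀)`): the restriction of `L₁`
  have hT₀sub : {w : Fin 2 → ℝ | 0 < w 1 ∧ w 1 < w 0 ∧ w 0 < x₀} ⊆ L₁.domain := by
    rw [hL₁]
    rintro w ⟨h1, h2, h3⟩
    exact ⟨h1, h2, h3.trans hx1⟩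
  obtain ⟨A, hAd, hAi'⟩ : ∃ A : KZ.IntegralRep 2,
      A.domain = {w : Fin 2 → ℝ | 0 < w 1 ∧ w 1 < w 0 ∧ w 0 < x₀} ∧ A.integrand = L₁.integrand :=
    ⟨L₁.restrict _ (goldenDilog_isSemialgebraic_triangle halg) hT₀sub, rfl, rfl⟩
  have hAi : EqOn A.integrand (fun w => 1 / (w 0 * (1 - w 1))) A.domain := fun w hw => by
    rw [hAi']
    exact hL₁i (hT₀sub (hAd ▸ hw))
  -- `C = [{0<v<u<x₀}, 1/(u(1+v))]` (`−Li₂(−x₀)`), dominated by `A`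
  have hT : ∀ w ∈ A.domain, 0 < w 0 ∧ 0 < w 1 ∧ w 1 < 1 := fun w hw => by
    rw [hAd] at hw
    obtain ⟨h1, h2, h3⟩ := hw
    exact ⟨h1.trans h2, h1, h2.trans (h3.trans hx1)⟩
  have hCsa : IsSemialgebraicFunOn ℚ A.domain (fun w => 1 / (w 0 * (1 + w 1))) := by
    have hq : ∀ w ∈ A.domain, aeval w (X 0 * (1 + X 1) : MvPolynomial (Fin 2) ℚ) ≠ 0 := by
      intro w hw
      obtain ⟨h0, h1, -⟩ := hT w hw
      have h1' : (0 : ℝ) < 1 + w 1 := by linarith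
      simpa only [map_mul, map_add, map_one, MvPolynomial.aeval_X] using (mul_pos h0 h1').ne'
    exact (isSemialgebraicFunOn_aeval_div_aeval A.isSemialgebraic_domain 1 _ hq).congr
      fun w _ => by simp
  have hmeas : MeasurableSet A.domain := KZ.IntegralRep.measurableSet_domain_holds A
  have hCint : IntegrableOn (fun w => 1 / (w 0 * (1 + w 1))) A.domain := by
    refine Integrable.mono' A.integrableOn
      (KZ.aestronglyMeasurable_of_isSemialgebraicFunOn hCsa hmeas) ?_
    refine (ae_restrict_iff' hmeas).2 (Filter.Eventually.of_forall fun w hw => ?_)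
    obtain ⟨h0, h1, h2⟩ := hT w hw
    have e : A.integrand w = 1 / (w 0 * (1 - w 1)) := hAi hw
    have hpos : 0 < w 0 * (1 - w 1) := mul_pos h0 (by linarith)
    rw [e, Real.norm_eq_abs, abs_of_pos (one_div_pos.2 (mul_pos h0 (by linarith)))]
    exact one_div_le_one_div_of_le hpos (mul_le_mul_of_nonneg_left (by linarith) h0.le)
  obtain ⟨C, hCd, hCi⟩ : ∃ C : KZ.IntegralRep 2, C.domain = A.domain ∧
      C.integrand = fun w => 1 / (w 0 * (1 + w 1)) :=
    ⟨⟨A.domain, _, A.isSemialgebraic_domain, hCsa, hCint⟩, rfl, rfl⟩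
  have hCi' : EqOn C.integrand (fun w => 1 / (w 0 * (1 + w 1))) C.domain := fun w _ => by
    rw [hCi]
  -- `Q = [{0<v<u<x₀²}, 1/((1−u)(1−v))]` (`½ log²(1 − x₀²)`): the restriction of `S`
  have hT₁sub : {w : Fin 2 → ℝ | 0 < w 1 ∧ w 1 < w 0 ∧ w 0 < x₀ ^ 2} ⊆ S.domain := by
    rw [hS]
    rintro w ⟨h1, h2, h3⟩
    exact ⟨h1.trans h2, h3, h1, h2.trans h3⟩
  obtain ⟨Q, hQd, hQi'⟩ : ∃ Q : KZ.IntegralRep 2,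
      Q.domain = {w : Fin 2 → ℝ | 0 < w 1 ∧ w 1 < w 0 ∧ w 0 < x₀ ^ 2} ∧
        Q.integrand = S.integrand :=
    ⟨S.restrict _ (goldenDilog_isSemialgebraic_triangle halg2) hT₁sub, rfl, rfl⟩
  have hQi : EqOn Q.integrand (fun w => 1 / ((1 - w 0) * (1 - w 1))) Q.domain := fun w hw => by
    rw [hQi']
    exact hSi (hT₁sub (hQd ▸ hw))
  -- Euler's reflection at `x₀` (`1 − x₀ = x₀²`, so the `Li₂(1 − x₀)`-triangle is `G`)
  have hG' : G.domain = {w | 0 < w 1 ∧ w 1 < w 0 ∧ w 0 < 1 - x₀} := by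
    rw [hG, hsq]
  have hrefl : KZ.of L₁ - KZ.of A - KZ.of P - KZ.of G ∈ KZ.relations :=
    stub_eulerReflection x₀ halg hx0 hx1 L₁ A P G hL₁ hL₁i hAd hAi hP hPi hG' hGi
  -- duplication at `x₀`
  have hdup : KZ.of G - 2 • KZ.of A + 2 • KZ.of C ∈ KZ.relations :=
    stub_dilogDuplication x₀ halg hx0 hx1 G A C hG hGi hAd hAi (hCd.trans hAd) hCi'
  -- Landen at `x₀²` (`x₀²/(1 − x₀²) = x₀`, so the `−Li₂(−y)`-triangle is `C`)
  have hCd' : C.domain = {w | 0 < w 1 ∧ w 1 < w 0 ∧ w 0 < x₀ ^ 2 / (1 - x₀ ^ 2)} := by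
    rw [hCd, hAd, hy]
  obtain ⟨hlanA, hlanB⟩ :=
    stub_dilogLanden (x₀ ^ 2) halg2 hx20 hx21 C G Q S hCd' hCi' hG hGi hQd hQi hS hSi
  -- bookkeeping
  have hsum : 5 • KZ.of G + KZ.of S + 2 • KZ.of P - 2 • KZ.of L₁ =
      (KZ.of G - 2 • KZ.of A + 2 • KZ.of C) - 2 • (KZ.of L₁ - KZ.of A - KZ.of P - KZ.of G) -
        2 • (KZ.of C - KZ.of G - KZ.of Q) - (2 • KZ.of Q - KZ.of S) := by
    abel
  rw [hsum]
  exact KZ.relations.sub_mem (KZ.relations.sub_mem (KZ.relations.sub_mem hdup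
    (KZ.relations.nsmul_mem hrefl 2)) (KZ.relations.nsmul_mem hlanA 2)) hlanB

end Summit.KontsevichZagierPeriods.HyperbolicBloch.OffTetraSectorKernel

end
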